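import Mathlib
import Summits.Ventures.PercRepro2.Defs
import Summits.Ventures.PercRepro2.Harris
import Summits.Ventures.PercRepro2.Graph
import Summits.Ventures.PercRepro2.Events
import Summits.Ventures.PercRepro2.CondAvoidPA
import Summits.Ventures.PercRepro2.CondAvoidZPA

/-!
# (Z)-positive association given MIXED avoidance is FALSE: a kernel-checked refutation
(blind cell PercRepro2, mine-1 g49; proofs/MINE1-UNIONROW-K3.md §15.2, MINE-1.md §66)

`CondAvoid.zpa_given_avoid` says: conditionally on `{t ↮ X}` (a ONE-SIDED avoidance, `s ∈ X`),
(Z)-monotone functionals of the pair `(C_s, C_t)` — increasing in `C_s`, decreasing in `C_t` — are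
positively associated.  The question left open in §12.8 of the paper was whether the same holds
conditionally on a MIXED avoidance `{t ↮ X} ∩ {s ↮ Y}` (the cluster of `t` avoids one set, the
cluster of `s` another).  It does not.

THE WITNESS: the path `s – w – v – t` on four vertices `0 – 1 – 2 – 3` with every edge weight
`1/2`, `X = {s, w} = {0, 1}` (the cluster of `t` avoids `s` and `w`), `Y = {v, t} = {2, 3}` (the
cluster of `s` avoids `v` and `t`), and the (Z)-monotone indicators `Φ(W, C) = 1[w ∈ W]`
(`w ∈ C_s`) and `Φ'(W, C) = 1[v ∉ C]` (`v ∉ C_t`).  Every configuration has weight `1/8`; the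
conditioning event `A` holds on `5` of the `8` configurations (all but `sw ∧ wv`, `wv ∧ vt`),
`A ∩ {w ∈ C_s}` on `2` (`sw` open, `wv` closed), `A ∩ {v ∉ C_t}` on `3` (`vt` closed) and
`A ∩ {w ∈ C_s} ∩ {v ∉ C_t}` on `1` (`sw` open alone), so

  `E[Φ 1_A] · E[Φ' 1_A] = (2/8)·(3/8) = 6/64  >  5/64 = (1/8)·(5/8) = E[Φ Φ' 1_A] · P(A)`.

Mechanism: `s ↮ v` and `t ↮ w` are avoidances of the two different clusters acting on the same
middle edge `wv` — `w ∈ C_s` forces `wv` closed, which removes the constraint that `t ↮ w` puts on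
`vt`, so the two (Z)-increasing events are negatively correlated.  The masses are established by
`decide` (the `2³` configurations with the cell's own `prob`, `weight`, `avoidEvent`, `connEvent`,
`Conn` — reachability decided by Mathlib's `SimpleGraph.instDecidableRelReachable`); the functionals
are rewritten to indicators of decidable events first; the inequality then fails by `norm_num`.
Three definitions (`ends`, `p`, the two functionals), decidability instances for this instance only,
no notation; one seat.
-/

namespace Summit.Ventures.PercRepro2

namespace MixedAvoidRefutation

open CondAvoid

/-- The three edges of the path `0 – 1 – 2 – 3` (`s = 0`, `w = 1`, `v = 2`, `t = 3`). -/
def ends : Fin 3 → Sym2 (Fin 4) := ![s(0, 1), s(1, 2), s(2, 3)]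

/-- Every edge has weight `1/2`. -/
def p : Fin 3 → ℚ := fun _ => 1 / 2

/-- The weights are admissible. -/
lemma p_isProbVec : IsProbVec p := ⟨fun _ => by norm_num [p], fun _ => by norm_num [p]⟩

/-- One Bernoulli factor is `1/2` whatever the state of the edge. -/
lemma edgeFactor_eq (e : Fin 3) (b : Bool) : edgeFactor (p e) b = 1 / 2 := by
  cases b <;> norm_num [p, edgeFactor]

/-- Every configuration has weight `1/8`. -/
lemma weight_eq (ω : Config (Fin 3)) : weight p ω = 1 / 8 := by
  unfold weight
  simp only [edgeFactor_eq, Finset.prod_const, Finset.card_univ, Fintype.card_fin]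
  norm_num

/-- Open adjacency is decidable on this instance. -/
instance instDecOpenAdj (ω : Config (Fin 3)) (u v : Fin 4) : Decidable (OpenAdj ends ω u v) :=
  inferInstanceAs (Decidable (∃ e, ω e = true ∧ ends e = s(u, v)))

/-- Adjacency of the open subgraph is decidable. -/
instance instDecAdj (ω : Config (Fin 3)) : DecidableRel (openGraph ends ω).Adj := fun u v =>
  decidable_of_iff (u ≠ v ∧ OpenAdj ends ω u v) openGraph_adj.symm

/-- Connection is decidable (Mathlib: reachability on a finite graph). -/
instance instDecConn (ω : Config (Fin 3)) (u v : Fin 4) : Decidable (Conn ends ω u v) :=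
  inferInstanceAs (Decidable ((openGraph ends ω).Reachable u v))

/-- The mixed avoidance event `A = {t ↮ s, t ↮ w} ∩ {s ↮ v, s ↮ t}`. -/
def A : Set (Config (Fin 3)) := avoidEvent ends 3 {0, 1} ∩ avoidEvent ends 0 {2, 3}

/-- The event `U = {w ∈ C_s}`. -/
def U : Set (Config (Fin 3)) := connEvent ends 0 1

/-- The event `e = {v ∉ C_t}`. -/
def e : Set (Config (Fin 3)) := (connEvent ends 3 2)ᶜ

/-- Membership in `A` is decidable. -/
instance instDecA : DecidablePred (· ∈ A) := fun ω =>
  inferInstanceAs (Decidable ((∀ x ∈ ({0, 1} : Finset (Fin 4)), ¬ Conn ends ω 3 x) ∧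
    (∀ x ∈ ({2, 3} : Finset (Fin 4)), ¬ Conn ends ω 0 x)))

/-- Membership in `U` is decidable. -/
instance instDecU : DecidablePred (· ∈ U) := fun ω => inferInstanceAs (Decidable (Conn ends ω 0 1))

/-- Membership in `e` is decidable. -/
instance instDecE : DecidablePred (· ∈ e) := fun ω =>
  inferInstanceAs (Decidable (¬ Conn ends ω 3 2))

/-- `P(B) = |B| / 8` for every decidable event `B`. -/
lemma prob_eq_card (B : Set (Config (Fin 3))) [DecidablePred (· ∈ B)] :
    prob p B = ((Finset.univ.filter (· ∈ B)).card : ℚ) / 8 := by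
  rw [prob_eq_sum_filter]
  simp only [weight_eq, Finset.sum_const, nsmul_eq_mul]
  ring

/-- `8 · P(A) = 5`. -/
theorem card_A : (Finset.univ.filter (· ∈ A)).card = 5 := by decide

/-- `8 · P(A ∩ U) = 2`. -/
theorem card_AU : (Finset.univ.filter (· ∈ A ∩ U)).card = 2 := by decide

/-- `8 · P(A ∩ e) = 3`. -/
theorem card_Ae : (Finset.univ.filter (· ∈ A ∩ e)).card = 3 := by decide

/-- `8 · P(A ∩ U ∩ e) = 1`. -/
theorem card_AUe : (Finset.univ.filter (· ∈ A ∩ U ∩ e)).card = 1 := by decide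

open Classical in
/-- The (Z)-increasing functional `Φ(W, C) = 1[w ∈ W]` (`w = 1`). -/
noncomputable def Φ : Set (Fin 4) → Set (Fin 4) → ℚ := fun W _ => if (1 : Fin 4) ∈ W then 1 else 0

open Classical in
/-- The (Z)-increasing functional `Φ'(W, C) = 1[v ∉ C]` (`v = 2`). -/
noncomputable def Φ' : Set (Fin 4) → Set (Fin 4) → ℚ := fun _ C => if (2 : Fin 4) ∈ C then 0 else 1

/-- `Φ` is (Z)-monotone. -/
lemma isZMono_Φ : IsZMono Φ := by
  intro W W' C C' hW _
  unfold Φ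
  by_cases h1 : (1 : Fin 4) ∈ W
  · rw [if_pos h1, if_pos (hW h1)]
  · rw [if_neg h1]
    split_ifs <;> norm_num

/-- `Φ'` is (Z)-monotone. -/
lemma isZMono_Φ' : IsZMono Φ' := by
  intro W W' C C' _ hC
  unfold Φ'
  by_cases h2 : (2 : Fin 4) ∈ C'
  · rw [if_pos (hC h2), if_pos h2]
  · rw [if_neg h2]
    split_ifs <;> norm_num

/-- `Φ ≥ 0`. -/
lemma Φ_nonneg (W C : Set (Fin 4)) : 0 ≤ Φ W C := by unfold Φ; split_ifs <;> norm_num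

/-- `Φ' ≥ 0`. -/
lemma Φ'_nonneg (W C : Set (Fin 4)) : 0 ≤ Φ' W C := by unfold Φ'; split_ifs <;> norm_num

/-- `Φ ≤ 1`. -/
lemma Φ_le_one (W C : Set (Fin 4)) : Φ W C ≤ 1 := by unfold Φ; split_ifs <;> norm_num

/-- `Φ' ≤ 1`. -/
lemma Φ'_le_one (W C : Set (Fin 4)) : Φ' W C ≤ 1 := by unfold Φ'; split_ifs <;> norm_num

/-- `Φ(C_s, C_t) · 1_A = 1_{A ∩ U}` pointwise. -/
lemma Φ_mul_indicator (ω : Config (Fin 3)) :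
    Φ (cluster ends ω 0) (cluster ends ω 3) * A.indicator 1 ω = (A ∩ U).indicator 1 ω := by
  unfold Φ
  by_cases hA : ω ∈ A <;> by_cases hU : ω ∈ U
  · have h1 : (1 : Fin 4) ∈ cluster ends ω 0 := hU
    simp [hA, hU, h1, Set.indicator]
  · have h1 : (1 : Fin 4) ∉ cluster ends ω 0 := hU
    simp [hA, hU, h1, Set.indicator]
  · simp [hA, Set.indicator]
  · simp [hA, Set.indicator]

/-- `Φ'(C_s, C_t) · 1_A = 1_{A ∩ e}` pointwise. -/
lemma Φ'_mul_indicator (ω : Config (Fin 3)) :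
    Φ' (cluster ends ω 0) (cluster ends ω 3) * A.indicator 1 ω = (A ∩ e).indicator 1 ω := by
  unfold Φ'
  by_cases hA : ω ∈ A <;> by_cases he : ω ∈ e
  · have h2 : (2 : Fin 4) ∉ cluster ends ω 3 := he
    simp [hA, he, h2, Set.indicator]
  · have h2 : (2 : Fin 4) ∈ cluster ends ω 3 := by
      simpa [e, connEvent] using he
    simp [hA, he, h2, Set.indicator]
  · simp [hA, Set.indicator]
  · simp [hA, Set.indicator]

/-- `Φ(C_s, C_t) · Φ'(C_s, C_t) · 1_A = 1_{A ∩ U ∩ e}` pointwise. -/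
lemma ΦΦ'_mul_indicator (ω : Config (Fin 3)) :
    Φ (cluster ends ω 0) (cluster ends ω 3) * Φ' (cluster ends ω 0) (cluster ends ω 3) *
      A.indicator 1 ω = (A ∩ U ∩ e).indicator 1 ω := by
  unfold Φ Φ'
  by_cases hA : ω ∈ A
  · by_cases hU : ω ∈ U
    · have h1 : (1 : Fin 4) ∈ cluster ends ω 0 := hU
      by_cases he : ω ∈ e
      · have h2 : (2 : Fin 4) ∉ cluster ends ω 3 := he
        simp [hA, hU, he, h1, h2, Set.indicator]
      · have h2 : (2 : Fin 4) ∈ cluster ends ω 3 := by simpa [e, connEvent] using he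
        simp [hA, hU, he, h1, h2, Set.indicator]
    · have h1 : (1 : Fin 4) ∉ cluster ends ω 0 := hU
      simp [hA, hU, h1, Set.indicator]
  · simp [hA, Set.indicator]

/-- **The (Z)-PA inequality FAILS on the mixed avoidance `A`**:
`E[Φ 1_A] · E[Φ' 1_A] = 6/64 > 5/64 = E[Φ Φ' 1_A] · P(A)`. -/
theorem not_zpa_mixed :
    ¬ (expect p (fun ω => Φ (cluster ends ω 0) (cluster ends ω 3) * A.indicator 1 ω) *
        expect p (fun ω => Φ' (cluster ends ω 0) (cluster ends ω 3) * A.indicator 1 ω) ≤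
      expect p (fun ω => Φ (cluster ends ω 0) (cluster ends ω 3) *
          Φ' (cluster ends ω 0) (cluster ends ω 3) * A.indicator 1 ω) * prob p A) := by
  have e1 : expect p (fun ω => Φ (cluster ends ω 0) (cluster ends ω 3) * A.indicator 1 ω) =
      prob p (A ∩ U) := by
    rw [prob_eq_expect_indicator]; exact congrArg (expect p) (funext Φ_mul_indicator)
  have e2 : expect p (fun ω => Φ' (cluster ends ω 0) (cluster ends ω 3) * A.indicator 1 ω) =
      prob p (A ∩ e) := by
    rw [prob_eq_expect_indicator]; exact congrArg (expect p) (funext Φ'_mul_indicator)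
  have e3 : expect p (fun ω => Φ (cluster ends ω 0) (cluster ends ω 3) *
      Φ' (cluster ends ω 0) (cluster ends ω 3) * A.indicator 1 ω) = prob p (A ∩ U ∩ e) := by
    rw [prob_eq_expect_indicator]; exact congrArg (expect p) (funext ΦΦ'_mul_indicator)
  rw [e1, e2, e3, prob_eq_card (A ∩ U), prob_eq_card (A ∩ e), prob_eq_card (A ∩ U ∩ e),
    prob_eq_card A, card_AU, card_Ae, card_AUe, card_A]
  norm_num

/-- **(Z)-positive association given MIXED avoidance is false in general**: the statement of
`CondAvoid.zpa_given_avoid` with the one-sided avoidance `{t ↮ X}` replaced by the two-sided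
`{t ↮ X} ∩ {s ↮ Y}` (`s ∈ X`, `t ∈ Y`) fails — for admissible rational weights, on a finite graph,
for (Z)-monotone functionals with values in `[0, 1]`. -/
theorem not_zpa_given_mixed_avoid :
    ¬ ∀ (V E : Type) [Fintype V] [DecidableEq V] [Fintype E] [DecidableEq E] (p : E → ℚ),
      IsProbVec p → ∀ (ends : E → Sym2 V) (s t : V) (X Y : Finset V), s ∈ X → t ∈ Y →
      ∀ (Φ Φ' : Set V → Set V → ℚ), IsZMono Φ → IsZMono Φ' →
      (∀ W C, 0 ≤ Φ W C) → (∀ W C, 0 ≤ Φ' W C) → (∀ W C, Φ W C ≤ 1) → (∀ W C, Φ' W C ≤ 1) →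
      (let A := avoidEvent ends t X ∩ avoidEvent ends s Y
       expect p (fun ω => Φ (cluster ends ω s) (cluster ends ω t) * A.indicator 1 ω) *
          expect p (fun ω => Φ' (cluster ends ω s) (cluster ends ω t) * A.indicator 1 ω) ≤
        expect p (fun ω => Φ (cluster ends ω s) (cluster ends ω t) *
            Φ' (cluster ends ω s) (cluster ends ω t) * A.indicator 1 ω) * prob p A) := by
  intro h
  have := h (Fin 4) (Fin 3) p p_isProbVec ends 0 3 {0, 1} {2, 3} (by simp) (by simp) Φ Φ'
    isZMono_Φ isZMono_Φ' Φ_nonneg Φ'_nonneg Φ_le_one Φ'_le_one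
  exact not_zpa_mixed this

end MixedAvoidRefutation

end Summit.Ventures.PercRepro2
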